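import Summits.QuantumFields.YangMills.Theorems.BalabanUVNodesN16OfLeaf
import Literature.MathematicalPhysics.QuantumFieldTheory.Balaban1983to89.B8LeafKnitRS
import HarnessLib

/-!
# Route «BalabanUVNodes» (K3 `SpineGivenEndpointR11`), DAG node N16 = NE3 — N16 ∕ NE3 FROM NODE N05's LEAF OF RECORD `B8LeafKnitRS.B8LeafRS`
# (its conjuncts `t4` = `B8.Thm4Printed`, `p3` = `B8.Prop3Printed`) on n05-a's family `zdGF3 (M_n(ℂ)) L 1 len` over the univ sub-index,
# and N07's (H3ˢᵘᵖ) — the N05 → N16 edge with BOTH ends in their owners' typed currencies (`d = 4`)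

Cell `pub-ymgap`, seat `pub-ymgap-dag-n16-c` (R134 fan-out seat, strategy s1; HUMAN RULING D-0062; chair R424 venue), generation 0, file 6;
`--supports stmt-QuantumFields-19676`; `bears_on: R4∕N16 · edge N05 → N16`.

WHY.  File 5's `n16_of_leaf` consumes the BODIES `B8.Thm4Body c₁ B₁′` and `B8.Prop3Body cP 4 L C₂ inp B₀β` at explicit thresholds `c₁, cP` and a
window threshold `c₁′`.  Node N05's statement of record is the surviving leaf `B8LeafKnitRS.B8LeafRS d L C₂ B₁′ B₀′ B₁ B₂ c₁ inp B₀β loc fam lan cub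
toAxial` (NODE 00 binds `fam := famB8OfRecord θ β len = fun i : IdxB8 θ ↦ zdGF3 θ.𝔸 θ.L β len i.1`), whose fields `t4 : B8.Thm4Printed B₁′ (fun i ↦
(fam i).toGFData)` and `p3 : B8.Prop3Printed d L C₂ inp B₀β (fun i ↦ (fam i).toGFData2)` are `∃ c₁ > 0, Thm4Body …` and `∃ cP > 0, Prop3Body …`.
THIS FILE unpacks the two thresholds, produces the window threshold `c₁′` by file 5's `exists_window_print`, and states N16 ∕ NE3 from THE LEAF
OF RECORD's SHAPE at `𝔸 = M_n(ℂ)`, `d = 4`, `β₀ = 1`: one hypothesis `B8LeafRS 4 L C₂ B₁′ B₀′ B₁ B₂ c₁ inp B₀β loc (fun i ↦ zdGF3 (M_n ℂ) L 1 len i.1)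
lan cub toAxial` (only `t4`, `p3` are read), three letter lines (`0 < B₁′`, `5·4·L·B₀ ≤ B₁′`, `len`), then `∃ c₁′ > 0` with `16·(5·4·L·B₀)·c₁′ ≤ 1`
and file 5 §3's tail verbatim.

WHAT THIS FILE PROVES (kernel, theorems only, 0 `def`, 0 sorry): **`n16_of_b8LeafRS`** (module docstring).
HONEST FRAMING: bookkeeping by name; the leaf `B8LeafRS` on `zdGF3` at curved backgrounds = node N05's theorem (its t4 ∕ p3 are in the tree only
modulo n05-a's sockets `SockP5base ∕ SockP5 ∕ SockH59 ∕ SockP5u ∕ SockB9P3`, its t2 ∕ t8 are REFUTED off the univ sub-index by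
`B8LeafModelZd3Boundary` — hence the sub-index), (H3ˢᵘᵖ) = N07's [Balaban1985Variational] Thm 1 TYPE; N16 ∕ NE3 NOT discharged; count-neutral;
finite T⁴ at fixed ε — NOT ℝ⁴, NOT infinite volume, NOT OS, NOT a mass gap, NOT Clay.
-/

set_option autoImplicit false

open scoped BigOperators Matrix Matrix.Norms.L2Operator
open NormedSpace

namespace Summit.QuantumFields.YangMills.BalabanUVNodes.N16.OfLeafRS

open Literature.MathematicalPhysics.QuantumFieldTheory.Balaban1983to89
open B7Prop1Explicit B7Prop2Explicit
open B7Prop3Flat (c3)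
open B8LeafModelZd (ZdIdx)
open B8LeafModelZd3 (zdGF3)
open B8LeafKnitRS (B8LeafRS)
open Summit.QuantumFields.BalabanUV.T4Continuum
open BlockAverageCurrent (curConst)
open NE3EnergyWeightedCovShape (NE3EnergyRateWCov)
open NE3RightInverseSupLetters (frameC)
open NE3.LeafIndexSockets (LeafH3sup)
open MinimalActionRate (sfClass)
open OfLeaf (exists_window_print n16_of_leaf)

noncomputable section

variable {n : Type} [Fintype n] [DecidableEq n]

/-- **N16 · NE3 FROM NODE N05's LEAF OF RECORD ON `zdGF3 (M_n(ℂ))` OVER THE UNIV SUB-INDEX AND N07's (H3ˢᵘᵖ)** (`d = 4`, `L ≥ 2`, `N ≥ 1`, `β₀ = 1`;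
`𝔸 = M_n(ℂ)` with the `L²`-operator-norm C⋆-structure assembled in the statement).  `∃ r > 0, ∀ g > 0, ∃ C ≥ 0` (THE END's), then for all leaf
parameters `C₂ B₁′ B₀′ B₁ B₂ c₁ inp B₀β`, carriers `loc lan cub toAxial`, a length function `len ≥ 1` on its support with `len e_μ = 1`, letters
`0 < B₁′`, `5·4·L·B₀ ≤ B₁′`: the leaf `B8LeafRS 4 L C₂ B₁′ B₀′ B₁ B₂ c₁ inp B₀β loc (fun i ↦ zdGF3 (M_n ℂ) L 1 len i.1) lan cub toAxial` (over
`{i : ZdIdx 4 L // i.Ω 0 = univ}`) yields a threshold `c₁′ > 0` with `16·(5·4·L·B₀)·c₁′ ≤ 1` such that file 5 §3's tail holds verbatim: (Rb),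
`c′`-line, `α`-window with `α + 11·4²·α ≤ c₁′`, the leaf lines, the (3.35) schedule `𝒬 ∕ C₃₃₅`, `ε ≤ r`, `s₁`, `b`, `s₂` with the Thm-4 output constants
`B := 5·4·L·B₀`, `B_h := 5·4·L·B₀β`, then `LeafH3sup 4 L N ε b′ c′ dom → NE3EnergyRateWCov 4 (sfClass 4 L N ε) L N b g C s₁ s₂ dom`.  Only the leaf's
`t4` and `p3` are read.  N16 ∕ NE3 NOT proved: the leaf is node N05's theorem, (H3ˢᵘᵖ) is N07's. [folklore] -/
theorem n16_of_b8LeafRS [Nonempty n] {L N : ℕ} (hL : 2 ≤ L) (hN : 1 ≤ N) :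
    letI : CStarAlgebra (Matrix n n ℂ) := {}
    ∃ r : ℝ, 0 < r ∧ ∀ ⦃g : ℝ⦄, 0 < g → ∃ C : ℝ, 0 ≤ C ∧
      ∀ {I₁ I₃ I₄ : Type} (C₂ B₁' B₀' B₁ B₂ c₁ : ℝ) (inp : B8.B9Inputs) (B₀β : ℝ) (loc : I₁ → B8.LocalData)
        (lan : I₃ → B8.LandauData) (cub : I₄ → B8.CubeData) (len : Site 4 → ℝ)
        (toAxial : ∀ i : {i : ZdIdx 4 L // i.Ω 0 = Set.univ},
          (zdGF3 (Matrix n n ℂ) L 1 len i.1).Cfg → (zdGF3 (Matrix n n ℂ) L 1 len i.1).Pert → (zdGF3 (Matrix n n ℂ) L 1 len i.1).Pert),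
      (∀ v : Site 4, 0 < len v → 1 ≤ len v) → (∀ μ : Fin 4, len (e μ) = 1) → 0 < B₁' → 5 * ((4 : ℕ) : ℝ) * L * inp.B₀ ≤ B₁' →
      B8LeafRS 4 (L : ℝ) C₂ B₁' B₀' B₁ B₂ c₁ inp B₀β loc
        (fun i : {i : ZdIdx 4 L // i.Ω 0 = Set.univ} => zdGF3 (Matrix n n ℂ) L 1 len i.1) lan cub toAxial →
      ∃ c₁' : ℝ, 0 < c₁' ∧ 16 * (5 * ((4 : ℕ) : ℝ) * L * inp.B₀ * c₁') ≤ 1 ∧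
      ∀ ⦃b' c' : ℝ⦄, 0 ≤ b' → 0 ≤ c' →
      2 ^ 15 * ((4 : ℝ) + 1) ^ 2 * ((4 : ℝ) + 4) ^ 2 * (L : ℝ) ^ 2 * b' ≤ 1 →
      23040 * (4 : ℝ) ^ 4 * (frameC 4 L + 4) ^ 3 * (c' + curConst 4 L * b' ^ 2) ≤ 1 →
      ∀ ⦃α : ℝ⦄, 0 < α → C0 4 * α ≤ 1 / 3 → 2 * α ≤ c2' 4 L → 11 * (4 : ℝ) ^ 2 * α ≤ 1 / 6 → α + 11 * (4 : ℝ) ^ 2 * α ≤ c₁' →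
      b' + 226 * (8 * ((4 : ℝ) + 1) * ((4 : ℝ) + 4)) ^ 2 * b' ^ 2 < α → 4 * ((4 : ℝ) - 1) * (c' + curConst 4 L * b' ^ 2) < α →
      ∀ ⦃Mc : ℝ⦄, 0 ≤ Mc → (Mc + 1) * (b' + 226 * (8 * ((4 : ℝ) + 1) * ((4 : ℝ) + 4)) ^ 2 * b' ^ 2) ≤ 1 / 2 →
      ∀ (𝒬 : ℕ → Set (Set (Site 4) × ℕ)), (∀ k, ∀ q ∈ 𝒬 k, q.2 ≤ k ∧ ∃ y : Site 4, ∀ z ∈ q.1, (l1 (z - y) : ℝ) ≤ Mc * (L : ℝ) ^ q.2) →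
      ∀ ⦃C335 : ℝ⦄, 2 * (Mc + 1) * (b' + 226 * (8 * ((4 : ℝ) + 1) * ((4 : ℝ) + 4)) ^ 2 * b' ^ 2) + 2 * Mc * (2 * (c' + curConst 4 L * b' ^ 2)) +
        4 * Mc * (1 + 2 * Mc) * (b' + 226 * (8 * ((4 : ℝ) + 1) * ((4 : ℝ) + 4)) ^ 2 * b' ^ 2) ^ 2 < C335 →
      ∀ ⦃ε s₁ b s₂ : ℝ⦄, 0 < ε → ε ≤ r → ε < α → 0 ≤ s₁ → s₁ ≤ r → 0 ≤ b → b ≤ ε / 2 →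
      5 * ((4 : ℕ) : ℝ) * L * inp.B₀ * (α + 11 * (4 : ℝ) ^ 2 * α) ≤ s₁ →
      5 * ((4 : ℕ) : ℝ) * L * inp.B₀ * (α + 11 * (4 : ℝ) ^ 2 * α) +
          2 * (b' + 226 * (8 * ((4 : ℝ) + 1) * ((4 : ℝ) + 4)) ^ 2 * b' ^ 2) * s₁ ≤ s₁ →
      5 * ((4 : ℕ) : ℝ) * L * inp.B₀ * (α + 11 * (4 : ℝ) ^ 2 * α) + 16 * (b' + 226 * (8 * ((4 : ℝ) + 1) * ((4 : ℝ) + 4)) ^ 2 * b' ^ 2) *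
          (5 * ((4 : ℕ) : ℝ) * L * inp.B₀ * (α + 11 * (4 : ℝ) ^ 2 * α)) ≤ s₁ →
      5 * ((4 : ℕ) : ℝ) * L * B₀β * (α + 11 * (4 : ℝ) ^ 2 * α) + 8 * (b' + 226 * (8 * ((4 : ℝ) + 1) * ((4 : ℝ) + 4)) ^ 2 * b' ^ 2) *
          (5 * ((4 : ℕ) : ℝ) * L * inp.B₀ * (α + 11 * (4 : ℝ) ^ 2 * α)) ≤ s₂ →
      ∀ {dom : _root_.Set (Site 4 → Fin 4 → (Matrix n n ℂ)ˣ)},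
        LeafH3sup 4 L N ε b' c' dom →
        NE3EnergyRateWCov 4 (sfClass 4 L N ε) L N b g C s₁ s₂ dom := by
  letI : CStarAlgebra (Matrix n n ℂ) := {}
  obtain ⟨r, hr0, hr⟩ := n16_of_leaf (n := n) hL hN
  refine ⟨r, hr0, fun g hg => ?_⟩
  obtain ⟨C, hC0, hC⟩ := hr hg
  refine ⟨C, hC0, fun {I₁ I₃ I₄} C₂ B₁' B₀' B₁ B₂ c₁ inp B₀β loc lan cub len toAxial hlen hlen1 hB₁' hBB leaf => ?_⟩
  -- the two thresholds of the leaf's `t4` ∕ `p3`, and the window threshold below them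
  obtain ⟨c₁t, hc₁t, hT⟩ := leaf.t4
  obtain ⟨cP, hcP, hP⟩ := leaf.p3
  obtain ⟨c₁', hc₁', hwin⟩ := exists_window_print (d := 4) (L := L) (by norm_num) hL C₂ hc₁t hcP hB₁'
  have hB0 : 0 ≤ 5 * ((4 : ℕ) : ℝ) * L * inp.B₀ := by have := inp.B₀_pos.le; positivity
  have h16 : 16 * (5 * ((4 : ℕ) : ℝ) * L * inp.B₀ * c₁') ≤ 1 := by
    obtain ⟨-, -, -, h, -⟩ := hwin (c₁' / 2) (c₁' / 2) (by linarith) (by linarith) (by linarith)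
    have h' : 16 * (B₁' * c₁') ≤ 1 := by rwa [add_halves] at h
    nlinarith [mul_le_mul_of_nonneg_right hBB hc₁'.le]
  refine ⟨c₁', hc₁', h16, fun b' c' hb' hc' hRb hcF α hα hA3 hA2 hAs hAc hb'α hc'α Mc hMc hMcα 𝒬 h𝒬 C335 hC335 ε s₁ b s₂ hε hεr hεα hs₁
    hs₁r hb hbh hss hgrad hℓ hhol dom h3 => ?_⟩
  exact hC c₁t c₁' B₁' cP C₂ B₀β inp len hlen hlen1 hB₁' hBB h16 hwin hb' hc' hRb hcF hα hA3 hA2 hAs hAc hb'α hc'α hMc hMcα 𝒬 h𝒬 hC335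
    hε hεr hεα hs₁ hs₁r hb hbh hss hgrad hℓ hhol hT hP h3

end

end Summit.QuantumFields.YangMills.BalabanUVNodes.N16.OfLeafRS
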